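import Literature.NumberTheory.DiophantineApproximation.CommonCoefficientCriterion
import Literature.NumberTheory.Transcendental.AperyIrrationality
import HarnessLib

/-!
# ζ(5) search — the COMMON-COEFFICIENT (shape III) dimension instance for `1, ζ(3), ζ(5)`
(cell `pub-zeta5`, family lane `fam-indep`)

HONEST FRAMING: systematic search; no irrationality claim unless certified.

`families/indep/FAMILY.md` §5.1/§5.8/§5.9 lists three criterion SHAPES by which a family can raise a
proved dimension: I (Nesterenko / Fischler–Zudilin, one form per `n` — `CriteriaDimension.lean`),
II (Marcovecchio's dual type-II criterion — staged `CriteriaTypeII.lean`), and III, the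
COMMON-COEFFICIENT criterion of Viola–Zudilin (J. reine angew. Math. 736 (2018), Lemma 5.1; tree
`Literature.NumberTheory.DiophantineApproximation.ViolaZudilin.intRelation_trivial_of_common_coefficient_forms`,
PROVED). This file is the shape-III instance for the pair `(ζ(3), ζ(5))` — the shape of the data a
Brown–Zudilin `N = 8` cell delivers (`I = 2(Qζ(5) − P) + 4ζ(2)(Qζ(3) − P̂)`, one common coefficient `Q_n`):
integer sequences `Q_n, P₃_n, P₅_n` with the `ζ(3)`-component FAST (`|Q_nζ(3) − P₃_n| ≤ e^{-ρ₂ n}`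
eventually) and the `ζ(5)`-component SLOW but small (`→ 0`, and `≥ e^{-ρ₁ n}` infinitely often,
`ρ₁ < ρ₂`) force `1, ζ(3), ζ(5)` to admit no non-trivial integer relation (dimension 3). Viola–Zudilin's
hypothesis (ii) ("`1, γ₁, …, γ_{S−1}` independent") is DISCHARGED here by Apéry's theorem, which is a
tree THEOREM (`Literature.NumberTheory.Transcendental.Apery.irrational_zeta_three`). REQUIREMENT in the cell's
rate units (`CRITERIA.md` §0): margin `min(c′, c″) + φ − δ > 0` for the two components AND distinct rates
with the `ζ(5)`-component the slower one — never cheaper than the T1 margin of the same cell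
(`families/indep/FAMILY.md` §5.9). Everything here is PROVED (an implication); no fact, no `sorry`,
no certificate is constructed.
-/

noncomputable section

open Filter Topology
open Literature.NumberTheory.Transcendental (zetaValue)
open Literature.NumberTheory.Transcendental.Apery (irrational_zeta_three)
open Literature.NumberTheory.DiophantineApproximation

namespace Summit.KontsevichZagierPeriods.Zeta5Search

/-- **Shape III for `(ζ(3), ζ(5))`.** Common-coefficient integer forms `Q_nζ(3) − P₃ n`, `Q_nζ(5) − P₅ n`
with `|Q_nζ(3) − P₃ n| ≤ e^{-ρ₂ n}` eventually, `Q_nζ(5) − P₅ n → 0` and `≥ e^{-ρ₁ n}` in absolute value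
infinitely often (`ρ₁ < ρ₂`, `0 < ρ₂`) leave NO non-trivial integer relation `a₀ + a₃ζ(3) + a₅ζ(5) = 0`
(Viola–Zudilin 2018 Lemma 5.1 with `S = 2`, `γ = (ζ(3), ζ(5))`, distinguished index `ζ(5)`; its
hypothesis (ii) is Apéry's theorem `irrational_zeta_three`). -/
theorem zetaThreeFive_intRelation_trivial_of_common_coefficient_forms
    (Q P₃ P₅ : ℕ → ℤ) {ρ₁ ρ₂ : ℝ} (hρ : ρ₁ < ρ₂) (hρ₂ : 0 < ρ₂)
    (h3 : ∀ᶠ n : ℕ in atTop, |(Q n : ℝ) * zetaValue 3 - P₃ n| ≤ Real.exp (-(ρ₂ * n)))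
    (h5zero : Tendsto (fun n : ℕ => (Q n : ℝ) * zetaValue 5 - P₅ n) atTop (𝓝 0))
    (h5big : ∃ᶠ n : ℕ in atTop, Real.exp (-(ρ₁ * n)) ≤ |(Q n : ℝ) * zetaValue 5 - P₅ n|)
    (a₀ a₃ a₅ : ℤ) (hrel : (a₀ : ℝ) + a₃ * zetaValue 3 + a₅ * zetaValue 5 = 0) :
    a₀ = 0 ∧ a₃ = 0 ∧ a₅ = 0 := by
  -- the data in Viola–Zudilin's format: `γ = (ζ(3), ζ(5))`, `P n = (P₃ n, P₅ n)`, `i₀ = 1`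
  let γ : Fin 2 → ℝ := ![zetaValue 3, zetaValue 5]
  let P : ℕ → Fin 2 → ℤ := fun n => ![P₃ n, P₅ n]
  have hsmall : ∀ i : Fin 2, i ≠ 1 → ∀ᶠ n : ℕ in atTop, |(Q n : ℝ) * γ i - P n i| ≤ Real.exp (-(ρ₂ * n)) := by
    intro i hi
    have hi0 : i = 0 := by
      rcases Fin.eq_zero_or_eq_succ i with h | ⟨j, hj⟩
      · exact h
      · exact absurd (by rw [hj]; exact congrArg Fin.succ (Fin.eq_zero j)) hi
    subst hi0
    simpa [γ, P] using h3
  have hzero : Tendsto (fun n : ℕ => (Q n : ℝ) * γ 1 - P n 1) atTop (𝓝 0) := by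
    simpa [γ, P] using h5zero
  have hbig : ∃ᶠ n : ℕ in atTop, Real.exp (-(ρ₁ * n)) ≤ |(Q n : ℝ) * γ 1 - P n 1| := by
    simpa [γ, P] using h5big
  -- hypothesis (ii): a relation not involving `ζ(5)` is trivial, by Apéry
  have hind : ∀ (b₀ : ℤ) (b : Fin 2 → ℤ), b 1 = 0 → (b₀ : ℝ) + ∑ i, (b i : ℝ) * γ i = 0 →
      b₀ = 0 ∧ b = 0 := by
    intro b₀ b hb1 hb
    have hb' : (b₀ : ℝ) + (b 0 : ℝ) * zetaValue 3 = 0 := by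
      simpa [Fin.sum_univ_two, γ, hb1] using hb
    have hb0 : b 0 = 0 := by
      by_contra hne
      apply irrational_zeta_three
      refine ⟨(-b₀ : ℚ) / (b 0 : ℚ), ?_⟩
      have hne' : ((b 0 : ℤ) : ℝ) ≠ 0 := by exact_mod_cast hne
      push_cast
      field_simp
      linarith
    have hb00 : b₀ = 0 := by
      have : (b₀ : ℝ) = 0 := by simpa [hb0] using hb'
      exact_mod_cast this
    refine ⟨hb00, ?_⟩
    funext i
    rcases Fin.eq_zero_or_eq_succ i with h | ⟨j, hj⟩
    · subst h; exact hb0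
    · have : i = 1 := by rw [hj]; exact congrArg Fin.succ (Fin.eq_zero j)
      subst this; exact hb1
  -- the relation in Viola–Zudilin's format
  have hrel' : (a₀ : ℝ) + ∑ i, ((![a₃, a₅] : Fin 2 → ℤ) i : ℝ) * γ i = 0 := by
    simpa [Fin.sum_univ_two, γ, add_assoc] using hrel
  obtain ⟨h0, h⟩ := ViolaZudilin.intRelation_trivial_of_common_coefficient_forms γ 1 Q P hρ hρ₂
    hsmall hzero hbig hind a₀ ![a₃, a₅] hrel'
  have h3' : a₃ = 0 := by simpa using congrFun h 0
  have h5' : a₅ = 0 := by simpa using congrFun h 1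
  exact ⟨h0, h3', h5'⟩

/-- Corollary (reading for the cell): under the same hypotheses `ζ(5) ∉ ℚ + ℚζ(3)` — in particular
`ζ(5)` is irrational (which the hypotheses `h5zero`, `h5big` give directly: the content of shape III
is the exclusion of the MIXED relations). -/
theorem zetaFive_not_mem_ratSpan_zetaThree_of_common_coefficient_forms
    (Q P₃ P₅ : ℕ → ℤ) {ρ₁ ρ₂ : ℝ} (hρ : ρ₁ < ρ₂) (hρ₂ : 0 < ρ₂)
    (h3 : ∀ᶠ n : ℕ in atTop, |(Q n : ℝ) * zetaValue 3 - P₃ n| ≤ Real.exp (-(ρ₂ * n)))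
    (h5zero : Tendsto (fun n : ℕ => (Q n : ℝ) * zetaValue 5 - P₅ n) atTop (𝓝 0))
    (h5big : ∃ᶠ n : ℕ in atTop, Real.exp (-(ρ₁ * n)) ≤ |(Q n : ℝ) * zetaValue 5 - P₅ n|) :
    ∀ u v : ℚ, zetaValue 5 ≠ u + v * zetaValue 3 := by
  intro u v huv
  -- clear denominators: `(u.den v.den) ζ5 = u.num v.den + v.num u.den ζ3`
  have key := zetaThreeFive_intRelation_trivial_of_common_coefficient_forms Q P₃ P₅ hρ hρ₂ h3 h5zero h5big
    (u.num * v.den) (v.num * u.den) (-(u.den * v.den : ℤ)) ?_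
  · obtain ⟨-, -, h⟩ := key
    have : (u.den : ℤ) * v.den ≠ 0 := by positivity
    omega
  · have hu : (u : ℝ) * u.den = u.num := by exact_mod_cast Rat.mul_den_eq_num u
    have hv : (v : ℝ) * v.den = v.num := by exact_mod_cast Rat.mul_den_eq_num v
    push_cast
    have : zetaValue 5 * (u.den * v.den) = (u * u.den) * v.den + (v * v.den) * u.den * zetaValue 3 := by
      rw [huv]; ring
    rw [hu, hv] at this
    linarith

end Summit.KontsevichZagierPeriods.Zeta5Search

end
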